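import Literature.MathematicalPhysics.QuantumLattice.FermionPartialTrace
import Literature.MathematicalPhysics.QuantumLattice.ConditionalFreeEnergyCertificate
import Literature.MathematicalPhysics.QuantumLattice.WindowEntropyIncrement
import Literature.LinearAlgebra.Matrix.HermitianCfcDiagonalForm
import HarnessLib

/-!
# The conditional free-energy certificate for a window of a lattice fermion system

Topic `MathematicalPhysics/QuantumLattice`, namespace `Literature.MathematicalPhysics.QuantumLattice`.

Let `Λ ⊆ ℤ^d` be a finite window whose lexicographically LARGEST site is `a`, `B = Λ ∖ a` the
"shield", and let `σ` be a density matrix on the local CAR algebra `𝔄_Λ = FermionOp Λ`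
(Jordan–Wigner in the lexicographic order), `σ_B = tr_{Λ→B} σ` its restriction to `𝔄_B`
(`fermionPartialTrace`, `FermionPartialTrace.lean`). For a Hermitian "energy" `H ∈ 𝔄_Λ`, a Hermitian
dual variable `L_B ∈ 𝔄_B` and a real `c`, the certificate

  `tr_{Λ→B} exp(−H + Γ(L_B)) ≤ e^c · exp(L_B)`   in `𝔄_B` (Löwner order; `Γ = fermionEmbed (B ⊆ Λ)`)

implies, for EVERY density matrix `σ` on `𝔄_Λ`,

  `S(σ) − S(σ_B) − Re tr(σ H) ≤ c`        (`fermion_condFreeEnergy_le_of_certificate`).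

This is `vonNeumannEntropy_sub_traceLeft_sub_le_of_certificate` (`ConditionalFreeEnergyCertificate.lean`:
Lindblad's tangent inequality + operator monotonicity of `log`) transported through the Jordan–Wigner
isomorphism: because `a` is the LAST site of the window, `B` is an initial segment, `𝔄_B ⊂ 𝔄_Λ` is a
genuine tensor factor (`ℋ_Λ = ℋ_a ⊗ ℋ_B`, no Jordan–Wigner string) and the fermionic partial trace is
the tensor partial trace (`toSpin_fermionPartialTrace_of_isLowerSet`). The transport is done once and
for all for an abstract initial segment `ι : Λ₁ ↪o Λ₂` and a site splitting `ε : Λ₂ ≃ A ⊕ Λ₁`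
(`fermion_condFreeEnergy_le_of_certificate_of_split`), then specialised to windows of `ℤ^d`.
It is the kernel form of the certificate "C1" of the `hubbard-thermal` free-energy programme
(Markov-entropy-decomposition upper bound on the pressure with a rational dual certificate
`(g, L_B, m)`, [cite: PoulinHastings2011, eqs. (4)–(8)]): combined with the window entropy bound of
`FermionEntropyChainRule.lean` it bounds `S(ρ) − β tr(ρ H_L)` of a translation-invariant torus state.
Everything is PROVED; the only definitions (`splitProdEquiv`, `eraseInclO`, `windowSplitEquiv`) are
coordinate bookkeeping with bodies.

## References

* D. Poulin, M. B. Hastings, Phys. Rev. Lett. 106 (2011) 080403, eqs. (4)–(8). [PoulinHastings2011]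
* G. Lindblad, Commun. Math. Phys. 40 (1975) 147–151, Lemma 2. [Lindblad1975]
* H. Araki, H. Moriya, Rev. Math. Phys. 15 (2003) 93–198, §4.1 (local CAR algebras). [ArakiMoriya2003]

## Implementation note

On concrete subtypes such as `PolySite Λ` two `DecidableEq` instances coexist (`Subtype.instDecidableEq`
and `LinearOrder.toDecidableEq`) which are NOT definitionally equal; the Jordan–Wigner lemmas of the tree
carry the latter. All spin-side (tensor-index) objects are therefore manipulated in §1–§2 over abstract
linearly ordered site types, where only the order instance exists, and §3 merely instantiates.
-/

noncomputable section

namespace Literature.MathematicalPhysics.QuantumLattice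

open Matrix Finset HubbardWave0 Literature.Probability.LatticeModels
open scoped ComplexOrder
open Literature.Computability.QuantumComplexity (traceLeft traceLeft_apply)
open Literature.InformationTheory.Entropy (vonNeumannEntropy vonNeumannEntropy_submatrix_equiv)
open Literature.LinearAlgebra.Matrix (cfc_submatrix_equiv)

/-! ### §1. An initial segment `Λ₁ ⊆ Λ₂` with a site splitting `Λ₂ ≃ A ⊔ Λ₁`: product coordinates -/

section TwoBlock

variable {X C : Type} [Fintype X] [DecidableEq X] [Fintype C] [DecidableEq C] {q : ℕ}

/-- **Tracing out the first block**: along `Sum.inr : C ↪ X ⊕ C` the spin partial trace is `Tr_X`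
(`traceLeft`) once configurations of `X ⊕ C` are read as pairs. [cite: NielsenChuang2010, §2.4.3 eq. (2.178)] -/
theorem spinPartialTrace_inr_eq_traceLeft_submatrix (σ : Op (X ⊕ C) q) :
    spinPartialTrace (Function.Embedding.inr : C ↪ X ⊕ C) σ =
      traceLeft (σ.submatrix (Equiv.sumArrowEquivProdArrow X C (Fin q)).symm
        (Equiv.sumArrowEquivProdArrow X C (Fin q)).symm) := by
  ext t s
  rw [spinPartialTrace_inr_apply, traceLeft_apply]
  rfl

end TwoBlock

section Split

open JordanWigner

variable {A Λ₁ Λ₂ : Type} [LinearOrder A] [Fintype A] [LinearOrder Λ₁] [Fintype Λ₁] [LinearOrder Λ₂]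
  [Fintype Λ₂]

/-- **Product coordinates** of the Fock space over `Λ₂` attached to a site splitting `ε : Λ₂ ≃ A ⊕ Λ₁`:
`(configuration of A) × (configuration of Λ₁) ≃ 𝒫(Orb Λ₂)` (Jordan–Wigner configurations, split along
`ε`). [cite: NielsenChuang2010, §2.4.3 eq. (2.178)] -/
def splitProdEquiv (ε : Λ₂ ≃ A ⊕ Λ₁) : TensorIndex A 4 × TensorIndex Λ₁ 4 ≃ Finset (Orb Λ₂) :=
  ((Equiv.sumArrowEquivProdArrow A Λ₁ (Fin 4)).symm.trans
    (Equiv.arrowCongr ε (Equiv.refl (Fin 4))).symm).trans JordanWigner.configEquiv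

/-- A matrix read in the product coordinates is its Jordan–Wigner image relabelled along `ε` and
read as a matrix on pairs. [folklore] -/
private theorem submatrix_splitProdEquiv_eq (ε : Λ₂ ≃ A ⊕ Λ₁) (M : Matrix (Finset (Orb Λ₂)) (Finset (Orb Λ₂)) ℂ) :
    M.submatrix (splitProdEquiv ε) (splitProdEquiv ε) =
      (reindexOp ε (toSpin M)).submatrix
        (Equiv.sumArrowEquivProdArrow A Λ₁ (Fin 4)).symm (Equiv.sumArrowEquivProdArrow A Λ₁ (Fin 4)).symm := by
  ext p p'
  simp only [Matrix.submatrix_apply, reindexOp_apply, toSpin_apply, splitProdEquiv, Equiv.trans_apply,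
    JordanWigner.configEquiv_apply]
  rfl

/-- **The marginal on an initial segment in product coordinates.** If `ι : Λ₁ ↪o Λ₂` is an initial
segment and `ε : Λ₂ ≃ A ⊕ Λ₁` splits the sites compatibly (`ι = inr ≫ ε⁻¹`), then tracing out the
`A`-factor of a matrix read in product coordinates gives the Jordan–Wigner image of its fermionic partial
trace along `ι`: `Tr_A (M)_{prod} = toSpin (tr_ι M)`. [cite: ArakiMoriya2003, §4.1] -/
theorem traceLeft_submatrix_splitProdEquiv (ι : Λ₁ ↪o Λ₂) (hι : IsLowerSet (Set.range ι))
    (ε : Λ₂ ≃ A ⊕ Λ₁)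
    (hιε : ι.toEmbedding = (Function.Embedding.inr : Λ₁ ↪ A ⊕ Λ₁).trans ε.symm.toEmbedding)
    (M : Matrix (Finset (Orb Λ₂)) (Finset (Orb Λ₂)) ℂ) :
    traceLeft (M.submatrix (splitProdEquiv ε) (splitProdEquiv ε)) =
      toSpin (fermionPartialTrace ι.toEmbedding M) := by
  rw [submatrix_splitProdEquiv_eq, ← spinPartialTrace_inr_eq_traceLeft_submatrix,
    toSpin_fermionPartialTrace_of_isLowerSet ι hι, hιε, spinPartialTrace_trans, spinPartialTrace_equiv,
    Equiv.symm_symm]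

/-! ### §2. The certificate theorem, abstract initial segment -/

/-- **Conditional free-energy certificate along an initial segment (abstract form).** Let
`ι : Λ₁ ↪o Λ₂` be an initial segment of the site order, split as `ε : Λ₂ ≃ A ⊕ Λ₁` with
`ι = inr ≫ ε⁻¹`; let `H` (on `Λ₂`) and `L_B` (on `Λ₁`) be Hermitian and suppose
`e^c · exp(L_B) − tr_ι exp(−H + Γ_ι L_B) ⪰ 0`. Then every density matrix `σ` on the Fock space over
`Λ₂` satisfies `S(σ) − S(tr_ι σ) − Re tr(σ H) ≤ c`. [cite: PoulinHastings2011, eqs. (4)–(8)]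
[cite: Lindblad1975, Lemma 2 p.149] -/
theorem fermion_condFreeEnergy_le_of_certificate_of_split (ι : Λ₁ ↪o Λ₂) (hι : IsLowerSet (Set.range ι))
    (ε : Λ₂ ≃ A ⊕ Λ₁)
    (hιε : ι.toEmbedding = (Function.Embedding.inr : Λ₁ ↪ A ⊕ Λ₁).trans ε.symm.toEmbedding)
    {σ H : Matrix (Finset (Orb Λ₂)) (Finset (Orb Λ₂)) ℂ} {LB : Matrix (Finset (Orb Λ₁)) (Finset (Orb Λ₁)) ℂ}
    {c : ℝ} (hσ : σ.PosSemidef) (htr : σ.trace = 1) (hH : H.IsHermitian) (hLB : LB.IsHermitian)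
    (hcert : ((Real.exp c : ℂ) • cfc Real.exp LB -
      fermionPartialTrace ι.toEmbedding (cfc Real.exp (-H + fermionEmbed ι.toEmbedding LB))).PosSemidef) :
    vonNeumannEntropy σ - vonNeumannEntropy (fermionPartialTrace ι.toEmbedding σ) - (σ * H).trace.re ≤ c := by
  set Φ := splitProdEquiv ε with hΦ
  set Xf : Matrix (Finset (Orb Λ₂)) (Finset (Orb Λ₂)) ℂ := -H + fermionEmbed ι.toEmbedding LB with hXf_def
  have hXf : Xf.IsHermitian := by
    rw [hXf_def]
    refine Matrix.IsHermitian.add hH.neg ?_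
    change (fermionEmbed ι.toEmbedding LB)ᴴ = fermionEmbed ι.toEmbedding LB
    rw [← fermionEmbed_conjTranspose, hLB.eq]
  -- the transported data
  have hρ' : (σ.submatrix Φ Φ).PosSemidef := hσ.submatrix Φ
  have htr' : (σ.submatrix Φ Φ).trace = 1 := by rw [trace_submatrix_equiv_equiv, htr]
  have hX' : (Xf.submatrix Φ Φ).IsHermitian := hXf.submatrix Φ
  have hLB' : (toSpin LB).IsHermitian := (isHermitian_toSpin_iff LB).2 hLB
  have hT4 : traceLeft (σ.submatrix Φ Φ) = toSpin (fermionPartialTrace ι.toEmbedding σ) :=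
    traceLeft_submatrix_splitProdEquiv ι hι ε hιε σ
  -- the linear identity `tr(ρ X) = tr(Tr_A ρ · L_B) − tr(ρ H)`
  have hXρ : (σ.submatrix Φ Φ * Xf.submatrix Φ Φ).trace =
      (traceLeft (σ.submatrix Φ Φ) * toSpin LB).trace - (σ.submatrix Φ Φ * H.submatrix Φ Φ).trace := by
    rw [hT4, ← map_mul, trace_toSpin, Matrix.submatrix_mul_equiv, trace_submatrix_equiv_equiv,
      Matrix.submatrix_mul_equiv, trace_submatrix_equiv_equiv, hXf_def, Matrix.mul_add, Matrix.trace_add,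
      Matrix.mul_neg, Matrix.trace_neg, Matrix.trace_mul_comm σ (fermionEmbed ι.toEmbedding LB),
      ← trace_mul_fermionPartialTrace, Matrix.trace_mul_comm LB]
    ring
  -- the transported certificate
  have hcert' : ((Real.exp c : ℂ) • cfc Real.exp (toSpin LB) -
      traceLeft (cfc Real.exp (Xf.submatrix Φ Φ))).PosSemidef := by
    have h1 : cfc Real.exp (Xf.submatrix Φ Φ) = (cfc Real.exp Xf).submatrix Φ Φ := cfc_submatrix_equiv hXf Φ _
    have h2 : traceLeft ((cfc Real.exp Xf).submatrix Φ Φ) =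
        toSpin (fermionPartialTrace ι.toEmbedding (cfc Real.exp Xf)) :=
      traceLeft_submatrix_splitProdEquiv ι hι ε hιε _
    have h3 : cfc Real.exp (toSpin LB) = toSpin (cfc Real.exp LB) := by
      have e : ∀ N : Matrix (Finset (Orb Λ₁)) (Finset (Orb Λ₁)) ℂ,
          toSpin N = N.submatrix JordanWigner.configEquiv JordanWigner.configEquiv := by
        intro N; ext k k'; simp
      rw [e, e, cfc_submatrix_equiv hLB]
    rw [h1, h2, h3, ← map_smul, ← map_sub]
    exact (posSemidef_toSpin_iff _).2 hcert
  have key := vonNeumannEntropy_sub_traceLeft_sub_le_of_certificate hρ' htr' hX' hLB' hXρ hcert'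
  -- read back
  have e1 : vonNeumannEntropy (σ.submatrix Φ Φ) = vonNeumannEntropy σ := vonNeumannEntropy_submatrix_equiv hσ.1 Φ
  have e2 : vonNeumannEntropy (traceLeft (σ.submatrix Φ Φ)) =
      vonNeumannEntropy (fermionPartialTrace ι.toEmbedding σ) := by
    rw [hT4]
    exact vonNeumannEntropy_toSpin (isHermitian_fermionPartialTrace ι.toEmbedding hσ.1)
  have e3 : (σ.submatrix Φ Φ * H.submatrix Φ Φ).trace = (σ * H).trace := by
    rw [Matrix.submatrix_mul_equiv, trace_submatrix_equiv_equiv]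
  rw [e1, e2, e3] at key
  exact key

end Split

/-! ### §3. Windows of `ℤ^d`: the shield `Λ ∖ a` below the largest site `a` -/

section Window

variable {d : ℕ}

/-- The shield `Λ ∖ a` inside the window, as an order embedding of site types. [folklore] -/
def eraseInclO (Λ : Finset (Site d)) (a : Site d) : PolySite (Λ.erase a) ↪o PolySite Λ :=
  OrderEmbedding.ofStrictMono (PolySite.incl (Finset.erase_subset a Λ)) fun _ _ h => h

/-- `eraseInclO` is the isotony embedding `PolySite.incl` of `𝔄(Λ ∖ a) ⊆ 𝔄(Λ)`. [cite: ArakiMoriya2003, §4.1 Def. 4.1 (2)] -/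
theorem eraseInclO_toEmbedding (Λ : Finset (Site d)) (a : Site d) :
    (eraseInclO Λ a).toEmbedding = PolySite.incl (Finset.erase_subset a Λ) :=
  DFunLike.ext _ _ fun _ => rfl

/-- If `a` is the lexicographically largest site of `Λ`, the shield `Λ ∖ a` is an initial segment of
the window. [cite: PoulinHastings2011, eq. (3)] -/
theorem isLowerSet_range_eraseInclO {Λ : Finset (Site d)} {a : Site d}
    (hmax : ∀ y ∈ Λ, toLex y ≤ toLex a) : IsLowerSet (Set.range (eraseInclO Λ a)) := by
  rintro y z hzy ⟨x, rfl⟩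
  have hzΛ : ofLex z.1 ∈ Λ := PolySite.ofLex_mem z
  have hza : ofLex z.1 ≠ a := by
    intro hza
    have hx : ofLex (x : PolySite (Λ.erase a)).1 ∈ Λ.erase a := PolySite.ofLex_mem x
    have hle : (x : PolySite (Λ.erase a)).1 ≤ toLex a := by
      have := hmax _ (Finset.mem_of_mem_erase hx)
      rwa [toLex_ofLex] at this
    have hge : toLex a ≤ (x : PolySite (Λ.erase a)).1 := by
      have h : z.1 ≤ (eraseInclO Λ a x).1 := hzy
      rwa [← toLex_ofLex z.1, hza] at h
    have heq : ofLex (x : PolySite (Λ.erase a)).1 = a :=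
      (congrArg ofLex (le_antisymm hle hge)).trans (ofLex_toLex a)
    exact (Finset.mem_erase.1 hx).1 heq
  exact ⟨PolySite.pt (ofLex z.1) (Finset.mem_erase.2 ⟨hza, hzΛ⟩), Subtype.ext rfl⟩

/-- The site bijection `Λ ≃ {a} ⊔ (Λ ∖ a)` (for `a ∈ Λ`). [folklore] -/
def windowSplitEquiv {Λ : Finset (Site d)} {a : Site d} (ha : a ∈ Λ) :
    PolySite Λ ≃ PolySite ({a} : Finset (Site d)) ⊕ PolySite (Λ.erase a) where
  toFun y :=
    if h : ofLex y.1 = a then Sum.inl (PolySite.pt a (Finset.mem_singleton_self a))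
    else Sum.inr (PolySite.pt (ofLex y.1) (Finset.mem_erase.2 ⟨h, PolySite.ofLex_mem y⟩))
  invFun := Sum.elim (fun z => PolySite.incl (Finset.singleton_subset_iff.2 ha) z)
    (fun z => PolySite.incl (Finset.erase_subset a Λ) z)
  left_inv y := by
    by_cases h : ofLex y.1 = a
    · simp only [h, dite_true, Sum.elim_inl]
      exact Subtype.ext ((congrArg toLex h).symm.trans (toLex_ofLex _))
    · simp only [h, dite_false, Sum.elim_inr]
      rfl
  right_inv z := by
    rcases z with z | z
    · have hz : ofLex (z : PolySite ({a} : Finset (Site d))).1 = a := Finset.mem_singleton.1 (PolySite.ofLex_mem z)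
      have h1 : ofLex (PolySite.incl (Finset.singleton_subset_iff.2 ha) z).1 = a := hz
      simp only [Sum.elim_inl, h1, dite_true, Sum.inl.injEq]
      exact Subtype.ext ((congrArg toLex hz).symm.trans (toLex_ofLex _))
    · have hz : ofLex (z : PolySite (Λ.erase a)).1 ≠ a := (Finset.mem_erase.1 (PolySite.ofLex_mem z)).1
      have h1 : ¬ ofLex (PolySite.incl (Finset.erase_subset a Λ) z).1 = a := hz
      simp only [Sum.elim_inr, h1, dite_false]
      exact congrArg Sum.inr (Subtype.ext rfl)

/-- Through the split, the shield is the second summand. [folklore] -/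
private theorem eraseInclO_eq_inr_trans {Λ : Finset (Site d)} {a : Site d} (ha : a ∈ Λ) :
    (eraseInclO Λ a).toEmbedding =
      (Function.Embedding.inr : PolySite (Λ.erase a) ↪ PolySite ({a} : Finset (Site d)) ⊕ PolySite (Λ.erase a)).trans
        (windowSplitEquiv ha).symm.toEmbedding :=
  DFunLike.ext _ _ fun _ => rfl

/-- **Conditional free-energy certificate for a lattice-fermion window.** Let `a` be the
lexicographically largest site of the window `Λ`, `B = Λ ∖ a`, `H ∈ 𝔄_Λ` and `L_B ∈ 𝔄_B` Hermitian,
`c` real, and suppose the certificate `e^c · exp(L_B) − tr_{B ⊆ Λ} exp(−H + Γ L_B) ⪰ 0` in `𝔄_B`.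
Then for every density matrix `σ ∈ 𝔄_Λ`: `S(σ) − S(σ_B) − Re tr(σ H) ≤ c`.
[cite: PoulinHastings2011, eqs. (4)–(8)] [cite: Lindblad1975, Lemma 2 p.149] -/
theorem fermion_condFreeEnergy_le_of_certificate {Λ : Finset (Site d)} {a : Site d} (ha : a ∈ Λ)
    (hmax : ∀ y ∈ Λ, toLex y ≤ toLex a)
    {σ H : FermionOp Λ} {LB : FermionOp (Λ.erase a)} {c : ℝ}
    (hσ : σ.PosSemidef) (htr : σ.trace = 1) (hH : H.IsHermitian) (hLB : LB.IsHermitian)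
    (hcert : ((Real.exp c : ℂ) • cfc Real.exp LB -
      fermionPartialTrace (PolySite.incl (Finset.erase_subset a Λ))
        (cfc Real.exp (-H + fermionEmbed (PolySite.incl (Finset.erase_subset a Λ)) LB))).PosSemidef) :
    vonNeumannEntropy σ - vonNeumannEntropy (fermionPartialTrace (PolySite.incl (Finset.erase_subset a Λ)) σ) -
      (σ * H).trace.re ≤ c := by
  rw [← eraseInclO_toEmbedding] at hcert ⊢
  exact fermion_condFreeEnergy_le_of_certificate_of_split (eraseInclO Λ a) (isLowerSet_range_eraseInclO hmax)
    (windowSplitEquiv ha) (eraseInclO_eq_inr_trans ha) hσ htr hH hLB hcert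

end Window

end Literature.MathematicalPhysics.QuantumLattice

end
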